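import Mathlib.Analysis.Complex.JensenFormula
import Literature.NumberTheory.LFunctions.GaussianHeckeZeroDensity
import Literature.NumberTheory.LFunctions.GaussianHeckeLogDerivPackage
import HarnessLib

/-!
# Counting the zeros of the Hecke `L`-functions `L(s, λ^m)` of `ℚ(i)`: finiteness, Jensen's bound
# per unit window, and Ricci's density bound in the trivial ranges

Topic `Literature/NumberTheory/LFunctions`, first PROVED layer under the named fact
`Literature.NumberTheory.LFunctions.GaussianHecke.ricci_zeroDensity` (`GaussianHeckeZeroDensity.lean`;
Huang–Liu–Rudnick 2020, Thm. 3 = Ricci 1976): the counting layer that every proof of a zero-density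
estimate for the family `D_m = 4 L(·, λ^m)` (`GaussianHecke.heckeL m`, `m ≥ 1`) needs.  Everything here
is PROVED; no definitions, no named facts.

* §1 `zeroBox_finite`, `zeroCountIn_eq_sum`, `zeroCountIn_anti`, `zeroCountIn_mono`,
  `zeroCountIn_eq_zero_of_one_le`: the zero set of the entire, not identically zero `D_m` is closed and
  discrete (Mathlib's `AnalyticOnNhd.preimage_zero_mem_codiscrete`), so the boxes
  `{D_m = 0, Re ≥ σ, |Im| < T}` of `GaussianHecke.zeroCountIn` are FINITE (their zeros have `Re < 1`,
  `GaussianHecke.heckeL_ne_zero_of_one_le_re`) and `zeroCountIn m σ T` is an honest finite sum of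
  multiplicities, antitone in `σ`, monotone in `T`, and `0` for `σ ≥ 1`.
* §2 `exists_finsum_divisor_le`, `exists_sum_window_le` — **Jensen's inequality** (Mathlib's
  `AnalyticOnNhd.sum_divisor_le`) on the discs `|s − (17/16 + iτ)| ≤ 7/8 < 5/4`, with the tree's
  uniform bound `‖D_m(z)‖ ≤ D(|Im z| + 2m + 4)²` (`GaussianHecke.norm_heckeL_le_mul_sq'`) and lower bound
  `‖D_m(17/16 + iτ)‖ ≥ B⁻¹` (`GaussianHecke.inv_le_norm_heckeL_centre`): the zeros with `β ≥ 1/2`,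
  `|γ − τ| ≤ 1/2`, counted with multiplicity, number `≤ A log(|τ| + 2m + 6)` with an ABSOLUTE `A`
  (uniform in `m ≥ 1` and `τ ∈ ℝ`) — the analogue of `N(T+1) − N(T) ≪ log(|T| + m)` used by
  Huang–Liu–Rudnick (§3.1: "`#{n : T ≤ |γ_{k,n}| < T+1} ≪ log(2|k|(T+2))`").
* §3 `exists_zeroCountIn_half_le`, `exists_zeroCount_half_le`: summing over the unit windows and over
  `m ≤ K`, **`N(1/2; T, K) ≤ A K (2T + 3) log(T + 2K + 7)`** — the "trivial" bound `≪ T K log K`.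
* §4 `ricci_bound_of_le_seven_tenths`, `zeroCount_eq_zero_of_one_le`, `ricci_reduction`:
  consequently the inequality of `ricci_zeroDensity` HOLDS in the ranges `1/2 ≤ σ ≤ 7/10` (where
  `K ≤ K^{(10/3)(1−σ)}`) and `σ ≥ 1` (no zeros), for every admissible `T = o(K)`, with `B = 1`; and the
  reduction of the full statement to large `K` (finitely many `K` are absorbed in the constant).  The
  range `7/10 < σ < 1` is the genuine density theorem (large sieve for Hecke polynomials, zero
  detection, and a Weyl-type bound for `L(1/2 + it, λ^m)`), carried out in the sequel files.

## References

* B. Huang, J. Liu, Z. Rudnick, *Gaussian primes in almost all narrow sectors*, Acta Arith. 193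
  (2020), 183–192, §2.3 Thm. 3 and §3.1. [HuangLiuRudnick2020]
* H. L. Montgomery, R. C. Vaughan, *Multiplicative Number Theory I*, CUP 2007, Lemma 6.1 (Jensen),
  Thm. 10.13 (the model `N(T+1) − N(T) ≪ log T`). [MontgomeryVaughan2007]
-/

noncomputable section

open Complex Filter Topology Set Metric MeromorphicOn Real

namespace Literature.NumberTheory.LFunctions

namespace GaussianHecke

/-! ### §1 Zeros of `D_m` (`m ≥ 1`): `Re < 1`, discreteness, finiteness of the boxes -/

/-- A zero of `D_m` (`m ≥ 1`) has real part `< 1` (non-vanishing on `Re s ≥ 1`). [folklore] -/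
theorem re_lt_one_of_heckeL_eq_zero {m : ℕ} (hm : m ≠ 0) {ρ : ℂ} (h : heckeL m ρ = 0) : ρ.re < 1 := by
  by_contra h1
  exact heckeL_ne_zero_of_one_le_re hm (not_lt.1 h1) h

/-- `D_m(2) ≠ 0` (absolute convergence). [folklore] -/
theorem heckeL_two_ne_zero (m : ℕ) : heckeL m 2 ≠ 0 :=
  heckeL_ne_zero_of_one_lt_re m (by norm_num)

/-- `D_m` (`m ≥ 1`) is analytic on a neighbourhood of every set (it is entire). [folklore] -/
theorem analyticOnNhd_heckeL {m : ℕ} (hm : m ≠ 0) (U : Set ℂ) : AnalyticOnNhd ℂ (heckeL m) U :=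
  fun z _ ↦ (differentiable_heckeL hm).analyticAt z

/-- The order of vanishing of `D_m` (`m ≥ 1`) at any point is finite (`D_m` is entire and
`D_m(2) ≠ 0`). [folklore] -/
theorem analyticOrderAt_heckeL_ne_top {m : ℕ} (hm : m ≠ 0) (ρ : ℂ) :
    analyticOrderAt (heckeL m) ρ ≠ ⊤ := by
  intro h
  have h0 := (AnalyticOnNhd.analyticOrderAt_eq_top_iff_eq_zero ρ
    (fun z ↦ (differentiable_heckeL hm).analyticAt z)).1 h
  exact heckeL_two_ne_zero m (by rw [h0]; rfl)

/-- At a zero of `D_m` (`m ≥ 1`) the multiplicity `(analyticOrderAt D_m ρ).toNat` is positive. [folklore] -/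
theorem toNat_analyticOrderAt_heckeL_pos {m : ℕ} (hm : m ≠ 0) {ρ : ℂ} (h : heckeL m ρ = 0) :
    0 < (analyticOrderAt (heckeL m) ρ).toNat := by
  have hne : analyticOrderAt (heckeL m) ρ ≠ 0 :=
    ((differentiable_heckeL hm).analyticAt ρ).analyticOrderAt_ne_zero.2 h
  obtain ⟨n, hn⟩ := ENat.ne_top_iff_exists.1 (analyticOrderAt_heckeL_ne_top hm ρ)
  rw [← hn, ENat.toNat_coe]
  rw [← hn] at hne
  exact Nat.pos_of_ne_zero fun h0 ↦ hne (by rw [h0]; rfl)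

/-- The zero set of `D_m` (`m ≥ 1`) is closed and discrete (isolated zeros of a not identically
vanishing entire function). [folklore] -/
theorem isClosed_and_isDiscrete_zeros {m : ℕ} (hm : m ≠ 0) :
    IsClosed {ρ : ℂ | heckeL m ρ = 0} ∧ IsDiscrete {ρ : ℂ | heckeL m ρ = 0} := by
  have h := (analyticOnNhd_heckeL hm Set.univ).preimage_zero_mem_codiscrete (x := 2)
    (heckeL_two_ne_zero m)
  exact compl_mem_codiscrete_iff.1 h

/-- A compact set contains only finitely many zeros of `D_m` (`m ≥ 1`). [folklore] -/
theorem finite_inter_zeros {m : ℕ} (hm : m ≠ 0) {K : Set ℂ} (hK : IsCompact K) :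
    (K ∩ {ρ : ℂ | heckeL m ρ = 0}).Finite := by
  obtain ⟨hc, hd⟩ := isClosed_and_isDiscrete_zeros hm
  exact (hK.inter_right hc).finite (hd.mono Set.inter_subset_right)

/-- **The boxes of `zeroCountIn` are finite**: for `m ≥ 1` the zeros of `D_m` with `Re ρ ≥ σ`,
`|Im ρ| < T` lie in the compact rectangle `[σ, 1] × [−T, T]`. [folklore] -/
theorem zeroBox_finite {m : ℕ} (hm : m ≠ 0) (σ T : ℝ) :
    {ρ : ℂ | heckeL m ρ = 0 ∧ σ ≤ ρ.re ∧ |ρ.im| < T}.Finite := by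
  refine (finite_inter_zeros hm ((isCompact_Icc (a := σ) (b := 1)).reProdIm
    (isCompact_Icc (a := -T) (b := T)))).subset ?_
  rintro ρ ⟨h0, h1, h2⟩
  rw [abs_lt] at h2
  exact ⟨Complex.mem_reProdIm.2 ⟨⟨h1, (re_lt_one_of_heckeL_eq_zero hm h0).le⟩, h2.1.le, h2.2.le⟩, h0⟩

/-- `zeroCountIn m σ T` as an honest finite sum of multiplicities over the finite box (`m ≥ 1`).
[folklore] -/
theorem zeroCountIn_eq_sum {m : ℕ} (hm : m ≠ 0) (σ T : ℝ) :
    zeroCountIn m σ T =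
      ∑ ρ ∈ (zeroBox_finite hm σ T).toFinset, (analyticOrderAt (heckeL m) ρ).toNat := by
  unfold zeroCountIn
  exact finsum_mem_eq_finite_toFinset_sum _ (zeroBox_finite hm σ T)

/-- `zeroCountIn m σ T` is antitone in `σ` (`m ≥ 1`). [folklore] -/
theorem zeroCountIn_anti {m : ℕ} (hm : m ≠ 0) {σ σ' : ℝ} (h : σ ≤ σ') (T : ℝ) :
    zeroCountIn m σ' T ≤ zeroCountIn m σ T := by
  rw [zeroCountIn_eq_sum hm, zeroCountIn_eq_sum hm]
  refine Finset.sum_le_sum_of_subset fun ρ hρ ↦ ?_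
  simp only [Set.Finite.mem_toFinset, Set.mem_setOf_eq] at hρ ⊢
  exact ⟨hρ.1, h.trans hρ.2.1, hρ.2.2⟩

/-- `zeroCountIn m σ T` is monotone in `T` (`m ≥ 1`). [folklore] -/
theorem zeroCountIn_mono {m : ℕ} (hm : m ≠ 0) (σ : ℝ) {T T' : ℝ} (h : T ≤ T') :
    zeroCountIn m σ T ≤ zeroCountIn m σ T' := by
  rw [zeroCountIn_eq_sum hm, zeroCountIn_eq_sum hm]
  refine Finset.sum_le_sum_of_subset fun ρ hρ ↦ ?_
  simp only [Set.Finite.mem_toFinset, Set.mem_setOf_eq] at hρ ⊢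
  exact ⟨hρ.1, hρ.2.1, lt_of_lt_of_le hρ.2.2 h⟩

/-- **No zeros to the right of `σ = 1`:** `zeroCountIn m σ T = 0` for `σ ≥ 1` (`m ≥ 1`). [folklore] -/
theorem zeroCountIn_eq_zero_of_one_le {m : ℕ} (hm : m ≠ 0) {σ : ℝ} (hσ : 1 ≤ σ) (T : ℝ) :
    zeroCountIn m σ T = 0 := by
  rw [zeroCountIn_eq_sum hm]
  refine Finset.sum_eq_zero fun ρ hρ ↦ ?_
  simp only [Set.Finite.mem_toFinset, Set.mem_setOf_eq] at hρ
  have := re_lt_one_of_heckeL_eq_zero hm hρ.1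
  linarith [hρ.2.1]

/-- `k ∈ [1, K]` is nonzero. [folklore] -/
theorem ne_zero_of_mem_Icc {k K : ℕ} (hk : k ∈ Finset.Icc 1 K) : k ≠ 0 :=
  Nat.one_le_iff_ne_zero.1 (Finset.mem_Icc.1 hk).1

/-- `N(σ; T, K) = 0` for `σ ≥ 1`. [folklore] -/
theorem zeroCount_eq_zero_of_one_le {σ : ℝ} (hσ : 1 ≤ σ) (T : ℝ) (K : ℕ) : zeroCount σ T K = 0 :=
  Finset.sum_eq_zero fun _ hk ↦ zeroCountIn_eq_zero_of_one_le (ne_zero_of_mem_Icc hk) hσ T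

/-- `N(σ; T, K)` is antitone in `σ`. [folklore] -/
theorem zeroCount_anti {σ σ' : ℝ} (h : σ ≤ σ') (T : ℝ) (K : ℕ) : zeroCount σ' T K ≤ zeroCount σ T K :=
  Finset.sum_le_sum fun _ hk ↦ zeroCountIn_anti (ne_zero_of_mem_Icc hk) h T

/-- `N(σ; T, K)` is monotone in `T`. [folklore] -/
theorem zeroCount_mono_T (σ : ℝ) {T T' : ℝ} (h : T ≤ T') (K : ℕ) : zeroCount σ T K ≤ zeroCount σ T' K :=
  Finset.sum_le_sum fun _ hk ↦ zeroCountIn_mono (ne_zero_of_mem_Icc hk) σ h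

/-! ### §2 Jensen's inequality on the discs `|s − (17/16 + iτ)| ≤ 7/8 < 5/4` -/

/-- On `U`, Mathlib's `divisor` of `D_m` (`m ≥ 1`) at `u ∈ U` is the multiplicity
`(analyticOrderAt D_m u).toNat` (all orders are finite). [folklore] -/
theorem divisor_heckeL_apply {m : ℕ} (hm : m ≠ 0) {U : Set ℂ} {u : ℂ} (hu : u ∈ U) :
    divisor (heckeL m) U u = ((analyticOrderAt (heckeL m) u).toNat : ℤ) := by
  rw [(analyticOnNhd_heckeL hm U).divisor_apply hu]
  obtain ⟨n, hn⟩ := ENat.ne_top_iff_exists.1 (analyticOrderAt_heckeL_ne_top hm u)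
  rw [← hn, ENat.map_coe, ENat.toNat_coe]
  rfl

/-- The real and imaginary parts of the Jensen centre `17/16 + iτ`. [folklore] -/
theorem jensenCentre_re_im (τ : ℝ) :
    ((17 / 16 : ℂ) + τ * I).re = 17 / 16 ∧ ((17 / 16 : ℂ) + τ * I).im = τ := by
  constructor <;> simp

/-- The unit window `1/2 ≤ Re z ≤ 1`, `|Im z − τ| ≤ 1/2` lies in the disc `|z − (17/16 + iτ)| ≤ 7/8`
(`(9/16)² + (1/2)² = 145/256 < 196/256`). [folklore] -/
theorem mem_closedBall_of_mem_window {τ : ℝ} {z : ℂ} (h1 : 1 / 2 ≤ z.re) (h2 : z.re ≤ 1)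
    (h3 : |z.im - τ| ≤ 1 / 2) : z ∈ closedBall ((17 / 16 : ℂ) + τ * I) (7 / 8) := by
  obtain ⟨hre, him⟩ := jensenCentre_re_im τ
  rw [mem_closedBall, dist_eq_norm, ← sq_le_sq₀ (norm_nonneg _) (by norm_num), Complex.sq_norm,
    Complex.normSq_apply, sub_re, sub_im, hre, him]
  rw [abs_le] at h3
  nlinarith

/-- On the larger disc `|z − (17/16 + iτ)| ≤ 5/4` one has `−1/2 ≤ Re z ≤ 3` and `|Im z| ≤ |τ| + 5/4`,
whence `‖D_m(z)‖ ≤ D (|τ| + 2m + 6)²` (`D = ∑_{z ≠ 0} N(z)^{-3/2}`, `GaussianHecke.norm_heckeL_le_mul_sq'`).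
[folklore] -/
theorem norm_heckeL_le_of_mem_bigDisc {m : ℕ} (hm : m ≠ 0) {τ : ℝ} {z : ℂ}
    (hz : z ∈ closedBall ((17 / 16 : ℂ) + τ * I) (5 / 4)) :
    ‖heckeL m z‖ ≤ (∑' x : GaussianInt, ((x.norm : ℤ) : ℝ) ^ (-(3 / 2 : ℝ))) * (|τ| + 2 * m + 6) ^ 2 := by
  obtain ⟨hre, him⟩ := jensenCentre_re_im τ
  rw [mem_closedBall, dist_eq_norm] at hz
  have h1 : |z.re - 17 / 16| ≤ 5 / 4 := by
    have h := abs_re_le_norm (z - ((17 / 16 : ℂ) + τ * I))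
    rw [sub_re, hre] at h
    exact h.trans hz
  have h2 : |z.im - τ| ≤ 5 / 4 := by
    have h := abs_im_le_norm (z - ((17 / 16 : ℂ) + τ * I))
    rw [sub_im, him] at h
    exact h.trans hz
  rw [abs_le] at h1 h2
  refine (norm_heckeL_le_mul_sq' hm (by linarith) (by linarith)).trans ?_
  have h3 : |z.im| ≤ |τ| + 5 / 4 := by
    rw [abs_le]
    have := neg_abs_le τ
    have := le_abs_self τ
    constructor <;> linarith
  have hm0 : (0 : ℝ) ≤ m := Nat.cast_nonneg m
  have h4 : |z.im| + 2 * m + 4 ≤ |τ| + 2 * m + 6 := by linarith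
  exact mul_le_mul_of_nonneg_left (pow_le_pow_left₀ (by positivity) h4 2)
    (normSum_pos (show (1 : ℝ) < 3 / 2 by norm_num)).le

/-- **Jensen's inequality for `D_m` on `|s − (17/16 + iτ)| ≤ 7/8`** (Mathlib's
`AnalyticOnNhd.sum_divisor_le` with `R = 5/4`, `M = D(|τ| + 2m + 6)²`, `‖D_m(centre)‖ ≥ B⁻¹`): there
is an absolute `A > 0` with `∑_u divisor(D_m)(u) ≤ A log(|τ| + 2m + 6)` for all `m ≥ 1`, `τ ∈ ℝ`
(zeros in the disc, with multiplicity). [cite: MontgomeryVaughan2007, Lemma 6.1] -/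
theorem exists_finsum_divisor_le :
    ∃ A : ℝ, 0 < A ∧ ∀ m : ℕ, m ≠ 0 → ∀ τ : ℝ,
      (∑ᶠ u, (divisor (heckeL m) (closedBall ((17 / 16 : ℂ) + τ * I) (7 / 8)) u : ℝ)) ≤
        A * Real.log (|τ| + 2 * m + 6) := by
  set D : ℝ := ∑' x : GaussianInt, ((x.norm : ℤ) : ℝ) ^ (-(3 / 2 : ℝ)) with hDdef
  set B : ℝ := ∑' x : GaussianInt, ((x.norm : ℤ) : ℝ) ^ (-(17 / 16 : ℝ)) with hBdef
  have hD1 : 1 ≤ D := one_le_normSum (by norm_num)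
  have hB1 : 1 ≤ B := one_le_normSum (by norm_num)
  have hDB1 : 1 ≤ D * B := by nlinarith
  have hlogDB : 0 ≤ Real.log (D * B) := Real.log_nonneg hDB1
  have hlog107 : (3 : ℝ) / 10 ≤ Real.log (10 / 7) := by
    have := Real.one_sub_inv_le_log_of_pos (x := (10 / 7 : ℝ)) (by norm_num)
    norm_num at this ⊢
    linarith
  have hden : 0 < Real.log (10 / 7) := by linarith
  refine ⟨(Real.log (D * B) + 2) / Real.log (10 / 7), by positivity, fun m hm τ ↦ ?_⟩
  set c : ℂ := (17 / 16 : ℂ) + τ * I with hc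
  set L : ℝ := |τ| + 2 * m + 6 with hL
  have hm1 : (1 : ℝ) ≤ m := by exact_mod_cast Nat.one_le_iff_ne_zero.2 hm
  have hL8 : 8 ≤ L := by have := abs_nonneg τ; linarith
  have hlogL : 1 ≤ Real.log L := by
    rw [Real.le_log_iff_exp_le (by linarith)]
    linarith [Real.exp_one_lt_d9]
  have hM : (1 : ℝ) ≤ D * L ^ 2 := by nlinarith
  have hfc : B⁻¹ ≤ ‖heckeL m c‖ := inv_le_norm_heckeL_centre m τ
  have hB0 : 0 < B := by linarith
  have hfcpos : 0 < ‖heckeL m c‖ := lt_of_lt_of_le (inv_pos.2 hB0) hfc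
  have hfc0 : heckeL m c ≠ 0 := norm_pos_iff.1 hfcpos
  have h1 : 0 < |(7 / 8 : ℝ)| := by norm_num
  have h2 : |(7 / 8 : ℝ)| < |(5 / 4 : ℝ)| := by
    rw [abs_of_pos (by norm_num), abs_of_pos (by norm_num)]; norm_num
  have h3 : AnalyticOnNhd ℂ (heckeL m) (closedBall c |(5 / 4 : ℝ)|) := analyticOnNhd_heckeL hm _
  have h4 : ∀ z ∈ sphere c |(5 / 4 : ℝ)|, ‖heckeL m z‖ ≤ D * L ^ 2 := by
    intro z hz
    rw [abs_of_pos (by norm_num)] at hz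
    exact norm_heckeL_le_of_mem_bigDisc hm (sphere_subset_closedBall hz)
  have hJ := AnalyticOnNhd.sum_divisor_le h1 h2 hM h3 hfc0 h4
  rw [abs_of_pos (by norm_num : (0 : ℝ) < 7 / 8)] at hJ
  have hcast : ((∑ᶠ u, divisor (heckeL m) (closedBall c (7 / 8)) u : ℤ) : ℝ) =
      ∑ᶠ u, (divisor (heckeL m) (closedBall c (7 / 8)) u : ℝ) :=
    map_finsum (Int.castRingHom ℝ)
      ((divisor (heckeL m) (closedBall c (7 / 8))).finiteSupport (isCompact_closedBall _ _))
  rw [← hcast]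
  refine hJ.trans ?_
  have hnum : Real.log (D * L ^ 2 / ‖heckeL m c‖) ≤ (Real.log (D * B) + 2) * Real.log L := by
    have hle : D * L ^ 2 / ‖heckeL m c‖ ≤ D * B * L ^ 2 := by
      rw [div_le_iff₀ hfcpos]
      have hBf : 1 ≤ B * ‖heckeL m c‖ := by
        calc (1 : ℝ) = B * B⁻¹ := by field_simp
          _ ≤ B * ‖heckeL m c‖ := by gcongr
      have hDL : 0 ≤ D * L ^ 2 := by positivity
      nlinarith
    calc Real.log (D * L ^ 2 / ‖heckeL m c‖) ≤ Real.log (D * B * L ^ 2) :=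
          Real.log_le_log (by positivity) hle
      _ = Real.log (D * B) + 2 * Real.log L := by
          rw [Real.log_mul (by positivity) (by positivity), Real.log_pow]; push_cast; ring
      _ ≤ (Real.log (D * B) + 2) * Real.log L := by nlinarith
  rw [show (5 : ℝ) / 4 / (7 / 8) = 10 / 7 by norm_num, div_mul_eq_mul_div]
  exact div_le_div_of_nonneg_right hnum hden.le

/-- **Zeros of `D_m` in a unit window, with multiplicity** (the analogue of
`N(T+1) − N(T) ≪ log(|T| + m)`; Huang–Liu–Rudnick §3.1 "`#{n : T ≤ |γ_{k,n}| < T+1} ≪ log(2|k|(T+2))`"):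
there is an absolute `A > 0` such that for all `m ≥ 1`, `τ ∈ ℝ` and every finite set `S` of zeros of
`D_m` with `Re ρ ≥ 1/2`, `|Im ρ − τ| ≤ 1/2`, `∑_{ρ ∈ S} mult(ρ) ≤ A log(|τ| + 2m + 6)`.
[cite: HuangLiuRudnick2020, §3.1] -/
theorem exists_sum_window_le :
    ∃ A : ℝ, 0 < A ∧ ∀ m : ℕ, m ≠ 0 → ∀ τ : ℝ, ∀ S : Finset ℂ,
      (∀ ρ ∈ S, heckeL m ρ = 0 ∧ 1 / 2 ≤ ρ.re ∧ |ρ.im - τ| ≤ 1 / 2) →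
        ∑ ρ ∈ S, ((analyticOrderAt (heckeL m) ρ).toNat : ℝ) ≤ A * Real.log (|τ| + 2 * m + 6) := by
  obtain ⟨A, hA, h⟩ := exists_finsum_divisor_le
  refine ⟨A, hA, fun m hm τ S hS ↦ le_trans ?_ (h m hm τ)⟩
  classical
  set U := closedBall ((17 / 16 : ℂ) + τ * I) (7 / 8) with hU
  set Dv := divisor (heckeL m) U with hDv
  have hD0 : ∀ u, 0 ≤ Dv u := fun u ↦ (analyticOnNhd_heckeL hm U).divisor_nonneg u
  have hfin : (Function.support Dv).Finite := Dv.finiteSupport (isCompact_closedBall _ _)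
  have hSU : ∀ ρ ∈ S, ρ ∈ U := fun ρ hρ ↦ by
    obtain ⟨h0, h1, h2⟩ := hS ρ hρ
    exact mem_closedBall_of_mem_window h1 (re_lt_one_of_heckeL_eq_zero hm h0).le h2
  have hSD : ∀ ρ ∈ S, ((analyticOrderAt (heckeL m) ρ).toNat : ℤ) = Dv ρ := fun ρ hρ ↦
    (divisor_heckeL_apply hm (hSU ρ hρ)).symm
  have hle : ∑ ρ ∈ S, ((analyticOrderAt (heckeL m) ρ).toNat : ℤ) ≤ ∑ᶠ u, Dv u := by
    rw [finsum_eq_sum_of_support_subset Dv (s := hfin.toFinset ∪ S) (by intro u hu; simp [hu])]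
    calc ∑ ρ ∈ S, ((analyticOrderAt (heckeL m) ρ).toNat : ℤ) = ∑ ρ ∈ S, Dv ρ :=
          Finset.sum_congr rfl hSD
      _ ≤ ∑ u ∈ hfin.toFinset ∪ S, Dv u :=
          Finset.sum_le_sum_of_subset_of_nonneg Finset.subset_union_right fun u _ _ ↦ hD0 u
  have hcast : ((∑ᶠ u, Dv u : ℤ) : ℝ) = ∑ᶠ u, (Dv u : ℝ) := map_finsum (Int.castRingHom ℝ) hfin
  rw [← hcast]
  exact_mod_cast hle

/-! ### §3 Counting in boxes: `N(1/2; T, K) ≪ T K log(T + K)` -/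

/-- The number of integers in `[−N, N]` is `2N + 1`. [folklore] -/
theorem card_Icc_neg_self (N : ℕ) : ((Finset.Icc (-(N : ℤ)) N).card : ℝ) = 2 * N + 1 := by
  have h : ((Finset.Icc (-(N : ℤ)) N).card : ℤ) = 2 * N + 1 := by
    rw [Int.card_Icc, Int.toNat_of_nonneg (by omega)]; ring
  exact_mod_cast h

/-- **Zeros of `D_m` with `β ≥ 1/2`, `|γ| < T`:** `N_m(1/2, T) ≤ A (2T + 3) log(T + 2m + 7)` with the
absolute `A` of `exists_sum_window_le` (cover `|γ| < T` by the unit windows at the integers `|j| ≤ ⌈T⌉`).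
[cite: HuangLiuRudnick2020, §3.1] -/
theorem exists_zeroCountIn_half_le :
    ∃ A : ℝ, 0 < A ∧ ∀ m : ℕ, m ≠ 0 → ∀ T : ℝ, 0 ≤ T →
      (zeroCountIn m (1 / 2) T : ℝ) ≤ A * (2 * T + 3) * Real.log (T + 2 * m + 7) := by
  obtain ⟨A, hA, h⟩ := exists_sum_window_le
  refine ⟨A, hA, fun m hm T hT ↦ ?_⟩
  classical
  rw [zeroCountIn_eq_sum hm, Nat.cast_sum]
  set S := (zeroBox_finite hm (1 / 2) T).toFinset with hS
  set N : ℕ := ⌈T⌉₊ with hN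
  have hNT : T ≤ N := Nat.le_ceil T
  have hN1 : (N : ℝ) < T + 1 := Nat.ceil_lt_add_one hT
  set J : Finset ℤ := Finset.Icc (-(N : ℤ)) N with hJ
  have hmaps : ∀ ρ ∈ S, round ρ.im ∈ J := by
    intro ρ hρ
    rw [hS, Set.Finite.mem_toFinset] at hρ
    obtain ⟨-, -, h2⟩ := hρ
    have hr := abs_sub_round ρ.im
    have h3 : |((round ρ.im : ℤ) : ℝ)| < N + 1 := by
      calc |((round ρ.im : ℤ) : ℝ)| = |ρ.im - (ρ.im - round ρ.im)| := by ring_nf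
        _ ≤ |ρ.im| + |ρ.im - round ρ.im| := abs_sub _ _
        _ < T + 1 / 2 := by linarith
        _ ≤ N + 1 := by linarith
    have h4 : |round ρ.im| < (N : ℤ) + 1 := by exact_mod_cast h3
    rw [hJ, Finset.mem_Icc]
    rw [abs_lt] at h4
    omega
  rw [← Finset.sum_fiberwise_of_maps_to hmaps]
  have hm0 : (0 : ℝ) ≤ m := Nat.cast_nonneg m
  have hfib : ∀ j ∈ J, ∑ ρ ∈ S.filter (fun ρ ↦ round ρ.im = j),
      ((analyticOrderAt (heckeL m) ρ).toNat : ℝ) ≤ A * Real.log (T + 2 * m + 7) := by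
    intro j hj
    have hwin : ∀ ρ ∈ S.filter (fun ρ ↦ round ρ.im = j),
        heckeL m ρ = 0 ∧ 1 / 2 ≤ ρ.re ∧ |ρ.im - ((j : ℤ) : ℝ)| ≤ 1 / 2 := by
      intro ρ hρ
      rw [Finset.mem_filter, hS, Set.Finite.mem_toFinset] at hρ
      obtain ⟨⟨h0, h1, -⟩, hj'⟩ := hρ
      refine ⟨h0, h1, ?_⟩
      rw [← hj']
      exact abs_sub_round ρ.im
    refine (h m hm ((j : ℤ) : ℝ) _ hwin).trans ?_
    have hjN : |((j : ℤ) : ℝ)| ≤ N := by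
      rw [hJ, Finset.mem_Icc] at hj
      have : |j| ≤ (N : ℤ) := abs_le.2 ⟨hj.1, hj.2⟩
      exact_mod_cast this
    have hpos : 0 < |((j : ℤ) : ℝ)| + 2 * m + 6 := by positivity
    exact mul_le_mul_of_nonneg_left (Real.log_le_log hpos (by linarith)) hA.le
  have hlog : 0 ≤ Real.log (T + 2 * m + 7) := Real.log_nonneg (by linarith)
  calc ∑ j ∈ J, ∑ ρ ∈ S.filter (fun ρ ↦ round ρ.im = j), ((analyticOrderAt (heckeL m) ρ).toNat : ℝ)
      ≤ ∑ j ∈ J, A * Real.log (T + 2 * m + 7) := Finset.sum_le_sum hfib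
    _ = (2 * N + 1) * (A * Real.log (T + 2 * m + 7)) := by
        rw [Finset.sum_const, nsmul_eq_mul, card_Icc_neg_self]
    _ ≤ (2 * T + 3) * (A * Real.log (T + 2 * m + 7)) := by
        apply mul_le_mul_of_nonneg_right _ (by positivity)
        linarith
    _ = A * (2 * T + 3) * Real.log (T + 2 * m + 7) := by ring

/-- **The trivial bound for the family:** `N(1/2; T, K) ≤ A K (2T + 3) log(T + 2K + 7)` (`T ≥ 0`,
absolute `A`), i.e. `N(1/2; T, K) ≪ T K log K` for `2 ≤ T ≤ K`. [cite: HuangLiuRudnick2020, §3.1] -/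
theorem exists_zeroCount_half_le :
    ∃ A : ℝ, 0 < A ∧ ∀ (K : ℕ) (T : ℝ), 0 ≤ T →
      (zeroCount (1 / 2) T K : ℝ) ≤ A * K * (2 * T + 3) * Real.log (T + 2 * K + 7) := by
  obtain ⟨A, hA, h⟩ := exists_zeroCountIn_half_le
  refine ⟨A, hA, fun K T hT ↦ ?_⟩
  unfold zeroCount
  rw [Nat.cast_sum]
  have hterm : ∀ k ∈ Finset.Icc 1 K,
      (zeroCountIn k (1 / 2) T : ℝ) ≤ A * (2 * T + 3) * Real.log (T + 2 * K + 7) := by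
    intro k hk
    have hkK : (k : ℝ) ≤ K := by exact_mod_cast (Finset.mem_Icc.1 hk).2
    have hk0 : (0 : ℝ) ≤ k := Nat.cast_nonneg k
    refine (h k (ne_zero_of_mem_Icc hk) T hT).trans ?_
    have hpos : 0 < T + 2 * k + 7 := by positivity
    exact mul_le_mul_of_nonneg_left (Real.log_le_log hpos (by linarith)) (by positivity)
  calc ∑ k ∈ Finset.Icc 1 K, (zeroCountIn k (1 / 2) T : ℝ)
      ≤ ∑ k ∈ Finset.Icc 1 K, A * (2 * T + 3) * Real.log (T + 2 * K + 7) := Finset.sum_le_sum hterm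
    _ = K * (A * (2 * T + 3) * Real.log (T + 2 * K + 7)) := by
        rw [Finset.sum_const, Nat.card_Icc, nsmul_eq_mul]
        simp
    _ = A * K * (2 * T + 3) * Real.log (T + 2 * K + 7) := by ring

/-! ### §4 Ricci's bound in the trivial ranges `σ ≤ 7/10` and `σ ≥ 1`; reduction to large `K` -/

/-- `T(K) = o(K)` gives `T(K) ≤ K` for all large `K`. [folklore] -/
theorem exists_forall_le_of_tendsto_div {T : ℕ → ℝ}
    (hT : Tendsto (fun K : ℕ => T K / K) atTop (𝓝 0)) :
    ∃ K₀ : ℕ, ∀ K, K₀ ≤ K → T K ≤ K := by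
  have h1 : ∀ᶠ K : ℕ in atTop, T K / K < 1 := (tendsto_order.1 hT).2 1 one_pos
  have h2 : ∀ᶠ K : ℕ in atTop, 1 ≤ K := eventually_ge_atTop 1
  obtain ⟨K₀, hK₀⟩ := Filter.eventually_atTop.1 (h1.and h2)
  refine ⟨K₀, fun K hK ↦ ?_⟩
  obtain ⟨h1K, h2K⟩ := hK₀ K hK
  have hKpos : (0 : ℝ) < K := by exact_mod_cast h2K
  rw [div_lt_one hKpos] at h1K
  exact h1K.le

/-- `log(T + 2K + 7) ≤ 4 log K` for `0 ≤ T ≤ K`, `K ≥ 2` (`3K + 7 ≤ 8K ≤ K⁴`). [folklore] -/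
theorem log_le_four_mul_log {T : ℝ} {K : ℕ} (hK : 2 ≤ K) (hTK : T ≤ K) (hT : 0 ≤ T) :
    Real.log (T + 2 * K + 7) ≤ 4 * Real.log K := by
  have hK2 : (2 : ℝ) ≤ K := by exact_mod_cast hK
  have hK3 : (8 : ℝ) ≤ (K : ℝ) ^ 3 := by
    have h := pow_le_pow_left₀ (by norm_num : (0 : ℝ) ≤ 2) hK2 3
    norm_num at h
    exact h
  have h1 : T + 2 * K + 7 ≤ (K : ℝ) ^ 4 := by nlinarith
  calc Real.log (T + 2 * K + 7) ≤ Real.log ((K : ℝ) ^ 4) := Real.log_le_log (by linarith) h1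
    _ = 4 * Real.log K := by rw [Real.log_pow]; norm_num

/-- **Ricci's inequality in the trivial range `1/2 ≤ σ ≤ 7/10`** (there `K ≤ K^{(10/3)(1−σ)}`, so
the trivial bound `N(σ; T, K) ≤ N(1/2; T, K) ≪ T K log K` suffices): for every `T = T(K) ≥ 2` with
`T(K) = o(K)` there is `C` with `N(σ; T(K), K) ≤ C T(K) K^{(10/3)(1−σ)} log K` for all `K ≥ 2`,
`1/2 ≤ σ ≤ 7/10` (finitely many `K` with `T(K) > K` are absorbed in `C`).
[cite: HuangLiuRudnick2020, Thm. 3] -/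
theorem ricci_bound_of_le_seven_tenths (T : ℕ → ℝ) (hT2 : ∀ K, 2 ≤ T K)
    (hT : Tendsto (fun K : ℕ => T K / K) atTop (𝓝 0)) :
    ∃ C : ℝ, ∀ K : ℕ, 2 ≤ K → ∀ σ : ℝ, 1 / 2 ≤ σ → σ ≤ 7 / 10 →
      (zeroCount σ (T K) K : ℝ) ≤ C * T K * (K : ℝ) ^ ((10 / 3 : ℝ) * (1 - σ)) * Real.log K := by
  obtain ⟨A, hA, h⟩ := exists_zeroCount_half_le
  obtain ⟨K₀, hK₀⟩ := exists_forall_le_of_tendsto_div hT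
  classical
  set N : ℕ := ∑ K ∈ Finset.range K₀, zeroCount (1 / 2) (T K) K with hN
  have hlog2 : 0 < Real.log 2 := Real.log_pos one_lt_two
  refine ⟨max (16 * A) (N / (2 * Real.log 2)), fun K hK σ hσ hσ' ↦ ?_⟩
  have hK2 : (2 : ℝ) ≤ K := by exact_mod_cast hK
  have hlogK : Real.log 2 ≤ Real.log K := Real.log_le_log two_pos hK2
  have hTK0 : 0 ≤ T K := by linarith [hT2 K]
  have hmono : (zeroCount σ (T K) K : ℝ) ≤ zeroCount (1 / 2) (T K) K := by
    exact_mod_cast zeroCount_anti hσ (T K) K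
  have hmax0 : 0 ≤ max (16 * A) (N / (2 * Real.log 2)) :=
    le_trans (by positivity) (le_max_left _ _)
  rcases lt_or_ge K K₀ with hlt | hge
  · -- finitely many small `K`: `N(σ) ≤ N`, and the right side is `≥ (N / (2 log 2)) · 2 · 1 · log 2 = N`
    have hNK : (zeroCount (1 / 2) (T K) K : ℝ) ≤ N := by
      have : zeroCount (1 / 2) (T K) K ≤ N :=
        Finset.single_le_sum (f := fun K ↦ zeroCount (1 / 2) (T K) K) (fun _ _ ↦ Nat.zero_le _)
          (Finset.mem_range.2 hlt)
      exact_mod_cast this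
    have hpow1 : (1 : ℝ) ≤ (K : ℝ) ^ ((10 / 3 : ℝ) * (1 - σ)) :=
      Real.one_le_rpow (by linarith) (by nlinarith)
    calc (zeroCount σ (T K) K : ℝ) ≤ N := hmono.trans hNK
      _ = N / (2 * Real.log 2) * 2 * 1 * Real.log 2 := by field_simp
      _ ≤ max (16 * A) (N / (2 * Real.log 2)) * T K * (K : ℝ) ^ ((10 / 3 : ℝ) * (1 - σ)) *
            Real.log K := by
          gcongr
          · exact le_max_right _ _
          · exact hT2 K
  · -- large `K`: `T(K) ≤ K`
    have hTK : T K ≤ K := hK₀ K hge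
    have hlog4 := log_le_four_mul_log hK hTK hTK0
    have h23 : 2 * T K + 3 ≤ 4 * T K := by linarith [hT2 K]
    have hKpow : (K : ℝ) ≤ (K : ℝ) ^ ((10 / 3 : ℝ) * (1 - σ)) := by
      have h1 : (1 : ℝ) ≤ (10 / 3 : ℝ) * (1 - σ) := by linarith
      calc (K : ℝ) = (K : ℝ) ^ (1 : ℝ) := (Real.rpow_one _).symm
        _ ≤ _ := Real.rpow_le_rpow_of_exponent_le (by linarith) h1
    have hlogpos : 0 ≤ Real.log (T K + 2 * K + 7) := Real.log_nonneg (by linarith)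
    calc (zeroCount σ (T K) K : ℝ) ≤ A * K * (2 * T K + 3) * Real.log (T K + 2 * K + 7) :=
          hmono.trans (h K (T K) hTK0)
      _ ≤ A * K * (4 * T K) * (4 * Real.log K) := by gcongr
      _ = 16 * A * T K * K * Real.log K := by ring
      _ ≤ max (16 * A) (N / (2 * Real.log 2)) * T K * (K : ℝ) ^ ((10 / 3 : ℝ) * (1 - σ)) *
            Real.log K := by
          gcongr
          exact le_max_left _ _

/-- **Reduction to large `K`.**  To prove the bound of `ricci_zeroDensity` (for a given exponent
`B > 0` and admissible `T`) it suffices to prove it for `K ≥ K₀`: the finitely many `K < K₀` are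
absorbed into the constant, because each `N(σ; T(K), K) ≤ N(1/2; T(K), K)` is a fixed natural number and
the right side is `≥ C · 2 · (log 2)^B` for `σ ≤ 1`, while both sides vanish-or-better for `σ > 1`.
[folklore] -/
theorem ricci_reduction {B : ℝ} (hB : 0 < B) (T : ℕ → ℝ) (hT2 : ∀ K, 2 ≤ T K) (K₀ : ℕ) {C₀ : ℝ}
    (h : ∀ K : ℕ, K₀ ≤ K → 2 ≤ K → ∀ σ : ℝ, 1 / 2 ≤ σ → σ ≤ 1 →
      (zeroCount σ (T K) K : ℝ) ≤ C₀ * T K * (K : ℝ) ^ ((10 / 3 : ℝ) * (1 - σ)) * Real.log K ^ B) :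
    ∃ C : ℝ, ∀ K : ℕ, 2 ≤ K → ∀ σ : ℝ, 1 / 2 ≤ σ →
      (zeroCount σ (T K) K : ℝ) ≤ C * T K * (K : ℝ) ^ ((10 / 3 : ℝ) * (1 - σ)) * Real.log K ^ B := by
  classical
  set N : ℕ := ∑ K ∈ Finset.range K₀, zeroCount (1 / 2) (T K) K with hN
  have hlog2 : 0 < Real.log 2 := Real.log_pos one_lt_two
  have hl2B : 0 < Real.log 2 ^ B := Real.rpow_pos_of_pos hlog2 B
  refine ⟨max (max C₀ 0) (N / (2 * Real.log 2 ^ B)), fun K hK σ hσ ↦ ?_⟩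
  have hK2 : (2 : ℝ) ≤ K := by exact_mod_cast hK
  have hTK0 : 0 ≤ T K := by linarith [hT2 K]
  have hmax0 : 0 ≤ max (max C₀ 0) (N / (2 * Real.log 2 ^ B)) :=
    le_trans (le_max_right _ _) (le_max_left _ _)
  have hrhs0 : 0 ≤ max (max C₀ 0) (N / (2 * Real.log 2 ^ B)) * T K *
      (K : ℝ) ^ ((10 / 3 : ℝ) * (1 - σ)) * Real.log K ^ B := by positivity
  rcases lt_or_ge 1 σ with h1 | h1
  · -- no zeros with `Re ≥ σ > 1`
    rw [zeroCount_eq_zero_of_one_le h1.le, Nat.cast_zero]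
    exact hrhs0
  rcases lt_or_ge K K₀ with hlt | hge
  · have hNK : (zeroCount σ (T K) K : ℝ) ≤ N := by
      have h' : zeroCount (1 / 2) (T K) K ≤ N :=
        Finset.single_le_sum (f := fun K ↦ zeroCount (1 / 2) (T K) K) (fun _ _ ↦ Nat.zero_le _)
          (Finset.mem_range.2 hlt)
      exact_mod_cast (zeroCount_anti hσ (T K) K).trans h'
    have hpow1 : (1 : ℝ) ≤ (K : ℝ) ^ ((10 / 3 : ℝ) * (1 - σ)) :=
      Real.one_le_rpow (by linarith) (by nlinarith)
    have hlogK : Real.log 2 ^ B ≤ Real.log K ^ B :=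
      Real.rpow_le_rpow hlog2.le (Real.log_le_log two_pos hK2) hB.le
    calc (zeroCount σ (T K) K : ℝ) ≤ N := hNK
      _ = N / (2 * Real.log 2 ^ B) * 2 * 1 * Real.log 2 ^ B := by field_simp
      _ ≤ max (max C₀ 0) (N / (2 * Real.log 2 ^ B)) * T K * (K : ℝ) ^ ((10 / 3 : ℝ) * (1 - σ)) *
            Real.log K ^ B := by
          gcongr
          · exact le_max_right _ _
          · exact hT2 K
  · calc (zeroCount σ (T K) K : ℝ) ≤ C₀ * T K * (K : ℝ) ^ ((10 / 3 : ℝ) * (1 - σ)) * Real.log K ^ B :=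
          h K hge hK σ hσ h1
      _ ≤ max (max C₀ 0) (N / (2 * Real.log 2 ^ B)) * T K * (K : ℝ) ^ ((10 / 3 : ℝ) * (1 - σ)) *
            Real.log K ^ B := by
          gcongr
          exact le_trans (le_max_left _ _) (le_max_left _ _)

end GaussianHecke

end Literature.NumberTheory.LFunctions
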